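import Summits.CriticalPhenomena.PercolationContinuityZ3.Theorems.Transplant.PlanarSkeletonFrmFromProxies
import Summits.CriticalPhenomena.PercolationContinuityZ3.Theorems.Transplant.SkelPhiProxyTransport
import HarnessLib

/-!
# U_s execution Us-1 module 4 (WAVE-Us-MANIFEST v1.0 §6(c) OPTION (a)): **THE PROXY MAP `prox` AND THE CONSUMER-SHAPED INPUTS AT AN ARBITRARY CENTRE**

builds on p205010 (kernel theorem, internal audit signed; external expert review pending) — nothing in this file uses p205010.  One definition (`HasProxies.prox`, the
choice of a proxy for every centre, review-queued), its spec lemmas, and the two sentences every GEN input-layer row uses in place of N2/U's `inputsAt_of_atQNQ … h1 c` /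
`zoneAt_of_atQNQ … h1 c`:
* `HasProxies.inputsAt_prox` — the served piece-link AT THE PROXY `h.prox c` (Us-1 module 1's frame form at the frame of `prox_spec`);
* **`HasProxies.inputsAt_proxR`** — the CONSUMER-SHAPED piece-link AT `c` for the consumer-side data `O.merged.toDataN.proxR h.prox D` (seed `Λ (prox c)`, kit radius `+ D`;
  width floor `D ≤ n`): served at the proxy, then Us-1 module 3's `eventNAt_some_subset_proxR` (set monotonicity; the oriented chart is `1`-Lipschitz by `lip_oriφ` and
  reads the same value at `c` and `prox c`) and `μ(A) ≤ μ(B)`;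
* `HasProxies.zoneAt_prox` — the zone input (no width condition; the consumer's zone family IS `Λ ∘ prox`).
U (one type) is the instance `prox = id`: `HasProxies.prox_eq_self_of_zero` (`D = 0` forces `prox c = c`).  Nothing about any open node (U, U_s) is claimed.
[cite: KozmaNitzan2024, §4 pp. 19–21 ((21)–(25): the inputs at every vertex)] [cite: MartineauTassion2017, §3.1–3.2] [this work]
-/

noncomputable section

open scoped Classical

namespace Summit.CriticalPhenomena.PercolationContinuityZ3.Theorems.Transplant

open MeasureTheory Literature.Probability.Percolation Literature.Probability.LatticeModels SimpleGraph KNCells KNLevels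
open Literature.Barriers.CriticalPhenomena (graphBall mem_graphBall_self graphBall_mono)
open SkelConc (Consts)
open Skelφ (oriφ lip_oriφ)
open Skelφ.StepI (OutNS eventNAt DataN)

namespace PlanarSkeletonFrmFrom

variable {V : Type} {G : SimpleGraph V} [G.LocallyFinite] {Φ : PlanarSkeletonFrmFrom G} {t : V} {D : ℕ}

/-! ## §1 The proxy map -/

/-- **The proxy map**: a proxy `prox c` chosen once for every centre `c` from `HasProxies` (same chart position, graph distance `≤ D`, a `t`-frame image).
[this work] -/
def HasProxies.prox (_h : Φ.HasProxies t D) (c : V) : V := if h' : Φ.HasProxies t D then Classical.choose (h' c) else c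

/-- The defining property of the chosen proxy. [folklore] -/
theorem HasProxies.prox_spec (h : Φ.HasProxies t D) (c : V) :
    ∃ α : G ≃g G, α t = h.prox c ∧ (∀ w, Φ.φ (α w) = Φ.φ w + (Φ.φ (h.prox c) - Φ.φ t)) ∧ Φ.φ (h.prox c) = Φ.φ c ∧ c ∈ graphBall G (h.prox c) D := by
  have hs := Classical.choose_spec (h c)
  simp only [HasProxies.prox, dif_pos h]
  exact hs

/-- The proxy has the centre's chart position. [folklore] -/
theorem HasProxies.φ_prox (h : Φ.HasProxies t D) (c : V) : Φ.φ (h.prox c) = Φ.φ c := by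
  obtain ⟨-, -, -, hcell, -⟩ := h.prox_spec c
  exact hcell

/-- The centre lies within graph distance `D` of its proxy. [folklore] -/
theorem HasProxies.mem_graphBall_prox (h : Φ.HasProxies t D) (c : V) : c ∈ graphBall G (h.prox c) D := by
  obtain ⟨-, -, -, -, hball⟩ := h.prox_spec c
  exact hball

/-- The proxy is a `t`-frame image. [folklore] -/
theorem HasProxies.exists_frame_prox (h : Φ.HasProxies t D) (c : V) :
    ∃ α : G ≃g G, α t = h.prox c ∧ ∀ w, Φ.φ (α w) = Φ.φ w + (Φ.φ (h.prox c) - Φ.φ t) := by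
  obtain ⟨α, hαt, hφ, -, -⟩ := h.prox_spec c
  exact ⟨α, hαt, hφ⟩

/-- The oriented chart reads the same value at the centre and at its proxy. [folklore] -/
theorem HasProxies.oriφ_prox (h : Φ.HasProxies t D) (b : Bool) (c : V) : oriφ Φ.φ b (h.prox c) = oriφ Φ.φ b c := by
  cases b
  · funext i; simp only [Skelφ.oriφ_false, Skelφ.trφ_apply, h.φ_prox c]
  · simp only [Skelφ.oriφ_true, h.φ_prox c]

/-- **U is the instance `prox = id`**: at radius `0` the proxy is the centre itself. [folklore] -/
theorem HasProxies.prox_eq_self_of_zero (h : Φ.HasProxies t 0) (c : V) : h.prox c = c := by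
  obtain ⟨w, hw⟩ := h.mem_graphBall_prox c
  have h0 : w.length = 0 := Nat.le_zero.1 hw
  exact ((SimpleGraph.Walk.eq_of_length_eq_zero h0)).symm ▸ rfl

/-! ## §2 The inputs served at the proxy, and the consumer-shaped inputs at the centre -/

variable [Countable V] {κ : Consts} {p : unitInterval} {hC : Φ.CylSubcritical p} {O : OutNS V} {q : unitInterval}

/-- **The served piece-link AT THE PROXY** `h.prox c` (`(M, n) ∈ 𝒞.SMn O`). [cite: KozmaNitzan2024, §4 pp. 19–21 ((21)–(25))] -/
theorem HasProxies.inputsAt_prox (h : Φ.HasProxies t D) (𝒞 : ChoiceNQ κ Φ t p hC) (hAt : 𝒞.AtQNQ O q) (c : V) {M n : ℕ} (hMn : (M, n) ∈ 𝒞.SMn O)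
    (fam : Fin 2) (τ : ℤˣ) :
    1 - 𝒞.δI < (bondPercolation G q).real
      (eventNAt G (oriφ Φ.φ (O.ori t M n)) O.merged.toDataN t (h.prox c) (M, some (n, fam, Skelφ.StepI.sgQ O.qd O.qdT O.ori t M n fam, τ))) := by
  obtain ⟨α, hαt, hφ⟩ := h.exists_frame_prox c
  exact ChoiceNQ.inputsAt_of_atQNQ_frame 𝒞 hAt hαt hφ hMn fam τ

/-- **THE CONSUMER-SHAPED PIECE-LINK AT AN ARBITRARY CENTRE `c`** (option (a)): with the consumer-side data `O.merged.toDataN.proxR h.prox D` (seed `Λ (prox c)`, kit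
radius `+ D`) and the width floor `D ≤ n`, the input is `(1 − δI)`-likely AT `c` — served at the proxy (`inputsAt_prox`), transported by set monotonicity
(`Skelφ.StepI.measureReal_eventNAt_some_proxR_le`). [this work] -/
theorem HasProxies.inputsAt_proxR (h : Φ.HasProxies t D) (𝒞 : ChoiceNQ κ Φ t p hC) (hAt : 𝒞.AtQNQ O q) (c : V) {M n : ℕ} (hMn : (M, n) ∈ 𝒞.SMn O)
    (hn : D ≤ n) (fam : Fin 2) (τ : ℤˣ) :
    1 - 𝒞.δI < (bondPercolation G q).real
      (eventNAt G (oriφ Φ.φ (O.ori t M n)) (O.merged.toDataN.proxR h.prox D) t c (M, some (n, fam, Skelφ.StepI.sgQ O.qd O.qdT O.ori t M n fam, τ))) :=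
  lt_of_lt_of_le (h.inputsAt_prox 𝒞 hAt c hMn fam τ)
    (Skelφ.StepI.measureReal_eventNAt_some_proxR_le (lip_oriφ Φ.lip _) (h.oriφ_prox _ c) (h.mem_graphBall_prox c) _ _ _ _ hn _ _ _)

/-- **The zone input AT THE PROXY** (`M ∈ 𝒞.Sz O`): the consumer's zone family is `Λ ∘ prox`, so this IS the consumer-shaped zone input at `c` (no width condition).
[cite: KozmaNitzan2024, §4 pp. 19–21 ((21)–(25))] -/
theorem HasProxies.zoneAt_prox (h : Φ.HasProxies t D) (𝒞 : ChoiceNQ κ Φ t p hC) (hAt : 𝒞.AtQNQ O q) (c : V) {M : ℕ} (hM : M ∈ 𝒞.Sz O) :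
    1 - 𝒞.δI < (bondPercolation G q).real (UniqZone.zone G (O.merged.Λ (h.prox c)) O.merged.k M) := by
  obtain ⟨α, hαt, hφ⟩ := h.exists_frame_prox c
  exact ChoiceNQ.zoneAt_of_atQNQ_frame 𝒞 hAt hαt hφ hM

/-- The zone input in `eventNAt` form for the consumer-side data at `c`. [folklore] -/
theorem HasProxies.zoneAt_proxR (h : Φ.HasProxies t D) (𝒞 : ChoiceNQ κ Φ t p hC) (hAt : 𝒞.AtQNQ O q) (c : V) {M : ℕ} (hM : M ∈ 𝒞.Sz O) (ψ : V → Site 2) :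
    1 - 𝒞.δI < (bondPercolation G q).real (eventNAt G ψ (O.merged.toDataN.proxR h.prox D) t c (M, none)) := by
  rw [Skelφ.StepI.eventNAt_none]
  exact h.zoneAt_prox 𝒞 hAt c hM

/-- **The centre lies in the consumer's seed** `Λ (prox c) k` at every seed level `k ≥ D` (the floor of hunk (iii)); `Λ = fatSeq` of LEVEL 0‴. [this work] -/
theorem HasProxies.mem_fatSeq_prox (h : Φ.HasProxies t D) (hC : Φ.CylSubcritical p) (c : V) {k : ℕ} (hk : D ≤ k) :
    c ∈ Skelφ.fatSeq (G := G) (φ := Φ.φ) (types := Φ.types) Φ.frame hC (h.prox c) k :=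
  Skelφ.mem_fatSeq_of_mem_graphBall Φ.lip Φ.frame hC (h.mem_graphBall_prox c) hk

end PlanarSkeletonFrmFrom

end Summit.CriticalPhenomena.PercolationContinuityZ3.Theorems.Transplant

end
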